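import Literature.Barriers.AnomalousDissipation.IntermittentDissipationSteps
import Literature.Analysis.FunctionSpaces.TorusConvolution
import HarnessLib

/-!
# De Rosa–Isett's Eulerian intermittency theorem (Thm. 2.7): the two steps of §5.1 and the assembly

`Literature.Barriers.AnomalousDissipation.IntermittentDissipationSteps` vendors as the named fact
`DeRosaIsett2024_thm27` the Eulerian intermittency theorem of De Rosa–Isett (ARMA 248 (2024) =
arXiv:2212.08176, Thm. 2.7): a weak Euler solution `v ∈ L^q(0,T; B^θ_{q,∞}(T^d))`, `q ∈ [3,∞)`,
whose Duchon–Robert distribution `D` is supported on a closed space–time set `S` with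
`vol((S)_δ) ≲ δ^{d-γ}` has `D ≡ 0` as soon as `2θ/(1-θ) > 1 - (1 - 3/q)(d-γ)`.

This file **decomposes** that fact along the printed proof (op. cit. §5.1, D-0014) into the
two statements the last paragraph of the proof combines, and **proves the combination**:

* `DeRosaIsett2024_s51_finalBound` — the a-priori estimate **(final_bound_D)** of §5.1 with the
  two support reductions (split_D)–(support_condit) built in: for every test `φ` there are
  `M, ε₁` with
  `|D(φ) + D(φ ⋆ₓ k_ε)| ≤ M (ε^{3θ-1} δ^{a} + ε^{2θ} δ^{a-1})`, `a = (1 - 3/q)(d - γ)`,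
  for all `0 < ε < δ < ε₁`, where `φ ⋆ₓ k_ε` is the slice-wise spatial mollification of `φ` by
  the tree's torus mollifier `Torus.kernel ε` (`Literature.Analysis.FunctionSpaces.TorusMollifier`);
* `DeRosaIsett2024_s51_mollifiedLimit` — "clearly `⟨D^v_ε - D^v ∗ ρ_ε, φ⟩ → 0`" (op. cit. §5.1),
  in the form used here: `D(φ ⋆ₓ k_ε) → D(φ)` as `ε → 0⁺`;
* `DeRosaIsett2024_thm27_of_s51` (**proved**): the last paragraph of §5.1 — "choosing
  `δ = ε^α` and optimizing in `α` we obtain `α = 1 - θ` … which concludes the proof by letting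
  `ε → 0`": with `δ = ε^{1-θ}` both terms of (final_bound_D) are `ε^κ`,
  `κ = 2θ + (1-θ)(a-1) = (1-θ)(2θ/(1-θ) - 1 + a) > 0` exactly under the hypothesis of Thm. 2.7,
  so `D(φ) + D(φ ⋆ₓ k_ε) → 0` while `D(φ ⋆ₓ k_ε) → D(φ)`, whence `D(φ) = 0`.

## How the two facts render §5.1 (design notes)

The printed proof estimates the Constantin–E–Titi approximation `D^v_ε = R_ε : ∇v_ε` of the
Duchon–Robert distribution. The tree's Duchon–Robert machinery
(`Literature.Analysis.FluidPDE.DuchonRobertLocalBalance`, with the discharged identities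
`Torus.integral_kernelFlux_mul_eq_holds` and `Torus.symmTestField_identity_holds`) is written for
Duchon–Robert's own approximation `D_ε(v) = ¼∫∇φ^ε·δv|δv|²` and the *symmetric* pairing
`⟨v, v ⋆ K⟩`, for which the local energy balance tested against `ψ` produces `D(ψ) + D(ψ ⋆ₓ K)`
in place of CET's `2⟨D ∗ ρ_ε, ψ⟩`; the two facts are therefore stated for the symmetric quantity
`D(φ) + D(φ ⋆ₓ k_ε)`, which is what the discharge (sibling files) estimates through
(split_D)–(support_condit), the flux bound (est_D_first_easy), the transport/Reynolds commutators
(est_III)/(eul_Rey_err) and the pressure commutator (est_II) — the latter after one integration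
by parts onto the cut-off, so that single Besov regularity of the pressure in the `L^{q/2}` scale
(Calderón–Zygmund on `T^d`, the tree's named fact `Torus.eLpNorm_hessian_le_laplacian`) replaces
the double regularity (p_double_reg) used in print. Both facts keep the full hypothesis list of
`DeRosaIsett2024_thm27` (minus the threshold inequality, which only enters the assembly), so that
the assembly is literal.

## References

* L. De Rosa, P. Isett, *Intermittency and lower dimensional dissipation in incompressible
  fluids*, Arch. Ration. Mech. Anal. 248 (2024), Paper No. 11 = arXiv:2212.08176 (tex source
  read): Thm. 2.7, Lemma 5.2, §5.1 — (split_D), (est_D_first_easy), (support_condit),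
  (moll_local_energy), (eul_all_terms), (est_II), (eul_Rey_err), (est_III), (final_bound_D),
  (eulerian_final_bound). [DeRosaIsett2024]
* J. Duchon, R. Robert, Nonlinearity 13 (2000) 249–255, proof of Prop. 1 (the symmetric
  regularised balance). [DuchonRobert2000]
-/

open MeasureTheory Set Filter Metric Function
open _root_.Topology
open scoped ENNReal NNReal Convolution

noncomputable section

namespace Literature.Barriers.AnomalousDissipation

/-- **De Rosa–Isett 2024, §5.1, the a-priori bound (final_bound_D)** (with the support
reductions (split_D)–(support_condit) of the same proof built in), flat torus, `q ∈ [3,∞)`,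
symmetric Duchon–Robert form. Under the hypotheses of Thm. 2.7 (`DeRosaIsett2024_thm27`) except
the threshold inequality — `(v, p)` a distributional Euler solution on `T^d × (0,T)` with
`p ∈ L^{3/2}`, `v ∈ L^q(0,T; B^θ_{q,∞})`, `D` its Duchon–Robert distribution
(`Torus.HasLocalEnergyBalance T 0 v p 0 D`) supported in the closed set `S`, and
`vol((S)_δ) ≤ C δ^{d-γ}` for `0 < δ < δ₀` — for every test function `φ` supported in `(0,T)`
there are `M ≥ 0` and `ε₁ > 0` such that for all `0 < ε < δ < ε₁`
`|D(φ) + D(φ ⋆ₓ k_ε)| ≤ M · (ε^{3θ-1} δ^{a} + ε^{2θ} δ^{a-1})`, `a = (1 - 3/q)·(d - γ)`,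
where `(φ ⋆ₓ k_ε)(t) = φ(t) ⋆ k_ε` is the slice-wise spatial mollification by the torus mollifier
`k_ε = Torus.kernel ε` (printed: `|⟨D^v_ε, φ⟩| ≲ ε^{3θ-1}δ^{(d-γ)(p-3)/p} + ε^{2θ}δ^{(d-γ)(p-3)/p - 1}`
for `ε ≤ δ/2`, the implicit constant depending on `φ`, `‖v‖_{L^p_tB^θ_{p,∞}}` and the Minkowski
constant; here `D^v_ε` is replaced by the symmetric Duchon–Robert pairing, see the module
docstring, and all smallness conditions on `ε, δ` are absorbed in `ε₁`). [cite: DeRosaIsett2024, §5.1 (final_bound_D)] -/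
def DeRosaIsett2024_s51_finalBound : Prop :=
  ∀ (d : Type) [Fintype d] [DecidableEq d] (_hd : 2 ≤ Fintype.card d) (T : ℝ) (_hT : 0 < T)
    (v : ℝ → UnitAddTorus d → EuclideanSpace ℝ d) (p : ℝ → UnitAddTorus d → ℝ)
    (_hsol : Literature.Analysis.FluidPDE.Torus.IsDistributionalNSSolutionOn T 0 0 v p)
    (_hp : ∫⁻ t in Ioo 0 T, ∫⁻ x, ‖p t x‖ₑ ^ (3 / 2 : ℝ) < ∞)
    (q : ℝ≥0∞) (_hq : 3 ≤ q) (_hq' : q ≠ ∞) (θ : ℝ) (_hθ : 0 < θ ∧ θ < 1)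
    (_hv : Literature.Analysis.FunctionSpaces.MemLpBesovSup q θ q v volume (Ioo 0 T))
    (D : Literature.Analysis.FluidPDE.Torus.STFunctional d)
    (_hD : Literature.Analysis.FluidPDE.Torus.HasLocalEnergyBalance T 0 v p 0 D)
    (S : Set (ℝ × UnitAddTorus d)) (_hS : IsClosed S)
    (_hDS : ∀ ψ : ℝ → UnitAddTorus d → ℝ,
      Literature.Analysis.FunctionSpaces.Torus.IsSpaceTimeTestIoo T ψ →
        Disjoint (tsupport (uncurry ψ)) S → D ψ = 0)
    (γ : ℝ) (_hγ : 0 ≤ γ ∧ γ ≤ Fintype.card d)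
    (_hdim : ∃ C : ℝ≥0∞, C ≠ ∞ ∧ ∃ δ₀ : ℝ, 0 < δ₀ ∧ ∀ δ ∈ Ioo 0 δ₀,
      volume (thickening δ S) ≤ C * ENNReal.ofReal (δ ^ ((Fintype.card d : ℝ) - γ)))
    (φ : ℝ → UnitAddTorus d → ℝ)
    (_hφ : Literature.Analysis.FunctionSpaces.Torus.IsSpaceTimeTestIoo T φ),
    ∃ M ε₁ : ℝ, 0 ≤ M ∧ 0 < ε₁ ∧ ∀ ε δ : ℝ, 0 < ε → ε < δ → δ < ε₁ →
      |D φ + D (fun t => φ t ⋆ Literature.Analysis.FunctionSpaces.Torus.kernel ε)| ≤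
        M * (ε ^ (3 * θ - 1) * δ ^ ((1 - 3 / q).toReal * ((Fintype.card d : ℝ) - γ)) +
          ε ^ (2 * θ) * δ ^ ((1 - 3 / q).toReal * ((Fintype.card d : ℝ) - γ) - 1))

/-- **De Rosa–Isett 2024, §5.1: "Clearly, `⟨D^v_ε - D^v ∗ ρ_ε, φ⟩ → 0`"** — the regularised
Duchon–Robert distribution tested against a fixed test function converges, flat torus, symmetric
Duchon–Robert form: for a distributional Euler solution `(v, p)` on `T^d × (0,T)` with
`p ∈ L^{3/2}` and `v ∈ L^q(0,T; B^θ_{q,∞})`, `q ∈ [3, ∞)` (so `v ∈ L³`), its Duchon–Robert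
distribution `D` (`Torus.HasLocalEnergyBalance T 0 v p 0 D`, i.e. the local energy flux
`D(ψ) = ∫∫[½|v|²∂ₜψ + (½|v|² + p)⟪v,∇ψ⟫]` on tests) and a test function `φ` supported in `(0,T)`,
`D(φ ⋆ₓ k_ε) → D(φ)` as `ε → 0⁺`, `(φ ⋆ₓ k_ε)(t) = φ(t) ⋆ k_ε` the slice-wise mollification by
`Torus.kernel ε` (the mollified test is again a test, `∂ₜ(φ ⋆ₓ k_ε) = (∂ₜφ) ⋆ₓ k_ε → ∂ₜφ` and
`∇(φ ⋆ₓ k_ε) = (∇φ) ⋆ₓ k_ε → ∇φ` uniformly, against the integrable `|v|², (½|v|² + p)v`;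
Evans, App. C.4, Thm. 7). [cite: DeRosaIsett2024, §5.1] -/
def DeRosaIsett2024_s51_mollifiedLimit : Prop :=
  ∀ (d : Type) [Fintype d] [DecidableEq d] (T : ℝ) (_hT : 0 < T)
    (v : ℝ → UnitAddTorus d → EuclideanSpace ℝ d) (p : ℝ → UnitAddTorus d → ℝ)
    (_hsol : Literature.Analysis.FluidPDE.Torus.IsDistributionalNSSolutionOn T 0 0 v p)
    (_hp : ∫⁻ t in Ioo 0 T, ∫⁻ x, ‖p t x‖ₑ ^ (3 / 2 : ℝ) < ∞)
    (q : ℝ≥0∞) (_hq : 3 ≤ q) (_hq' : q ≠ ∞) (θ : ℝ) (_hθ : 0 < θ ∧ θ < 1)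
    (_hv : Literature.Analysis.FunctionSpaces.MemLpBesovSup q θ q v volume (Ioo 0 T))
    (D : Literature.Analysis.FluidPDE.Torus.STFunctional d)
    (_hD : Literature.Analysis.FluidPDE.Torus.HasLocalEnergyBalance T 0 v p 0 D)
    (φ : ℝ → UnitAddTorus d → ℝ)
    (_hφ : Literature.Analysis.FunctionSpaces.Torus.IsSpaceTimeTestIoo T φ),
    Tendsto (fun ε => D (fun t => φ t ⋆ Literature.Analysis.FunctionSpaces.Torus.kernel ε))
      (𝓝[>] 0) (𝓝 (D φ))

/-- The exponent bookkeeping of the last paragraph of §5.1: with `δ = ε^{1-θ}`,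
`ε^{3θ-1} δ^{a} + ε^{2θ} δ^{a-1} = 2 ε^{2θ + (1-θ)(a-1)}` for `ε > 0`. [cite: DeRosaIsett2024, §5.1 (eulerian_final_bound)] -/
theorem DeRosaIsett2024_s51_exponent_identity {ε θ a : ℝ} (hε : 0 < ε) :
    ε ^ (3 * θ - 1) * (ε ^ (1 - θ)) ^ a + ε ^ (2 * θ) * (ε ^ (1 - θ)) ^ (a - 1) =
      2 * ε ^ (2 * θ + (1 - θ) * (a - 1)) := by
  rw [← Real.rpow_mul hε.le, ← Real.rpow_mul hε.le, ← Real.rpow_add hε, ← Real.rpow_add hε]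
  have h1 : 3 * θ - 1 + (1 - θ) * a = 2 * θ + (1 - θ) * (a - 1) := by ring
  rw [h1]
  ring

/-- The threshold inequality of Thm. 2.7, `1 - a < 2θ/(1-θ)` with `θ < 1`, is exactly positivity
of the common exponent `κ = 2θ + (1-θ)(a-1)` obtained for `δ = ε^{1-θ}`
("`(2θ/(1-θ) - 1 + (d-γ)(p-3)/p)(1-θ)`", op. cit. (eulerian_final_bound)). [cite: DeRosaIsett2024, §5.1 (eulerian_final_bound)] -/
theorem DeRosaIsett2024_s51_exponent_pos {θ a : ℝ} (hθ : θ < 1) (hcond : 1 - a < 2 * θ / (1 - θ)) :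
    0 < 2 * θ + (1 - θ) * (a - 1) := by
  have h1 : 0 < 1 - θ := by linarith
  rw [lt_div_iff₀ h1] at hcond
  nlinarith

/-- **De Rosa–Isett 2024, Thm. 2.7 from the two steps of §5.1** (the last paragraph of the
printed proof): given the a-priori bound (final_bound_D) (`DeRosaIsett2024_s51_finalBound`) and
the convergence of the regularised pairing (`DeRosaIsett2024_s51_mollifiedLimit`), choose
`δ = ε^{1-θ}`; then `ε < δ < ε₁` for all small `ε > 0`, both error terms equal `ε^κ` with
`κ = 2θ + (1-θ)(a-1) > 0` by the threshold hypothesis, so `D(φ) + D(φ ⋆ₓ k_ε) → 0`, while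
`D(φ ⋆ₓ k_ε) → D(φ)`; uniqueness of limits along `ε → 0⁺` gives `2 D(φ) = 0`. [cite: DeRosaIsett2024, Thm. 2.7 and §5.1] -/
theorem DeRosaIsett2024_thm27_of_s51 (hA : DeRosaIsett2024_s51_finalBound)
    (hB : DeRosaIsett2024_s51_mollifiedLimit) : DeRosaIsett2024_thm27 := by
  intro d _ _ hd T hT v p hsol hp q hq hq' θ hθ hv D hD S hS hDS γ hγ hdim hcond ψ hψ
  obtain ⟨M, ε₁, hM, hε₁, hbound⟩ :=
    hA d hd T hT v p hsol hp q hq hq' θ hθ hv D hD S hS hDS γ hγ hdim ψ hψ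
  have hlim := hB d T hT v p hsol hp q hq hq' θ hθ hv D hD ψ hψ
  set a : ℝ := (1 - 3 / q).toReal * ((Fintype.card d : ℝ) - γ) with ha
  set κ : ℝ := 2 * θ + (1 - θ) * (a - 1) with hκ
  have hκpos : 0 < κ := DeRosaIsett2024_s51_exponent_pos hθ.2 hcond
  set f : ℝ → ℝ := fun ε =>
    D (fun t => ψ t ⋆ Literature.Analysis.FunctionSpaces.Torus.kernel ε) with hf
  -- the common error `2 M ε^κ → 0` along `ε → 0⁺`
  have hpow : Tendsto (fun ε : ℝ => 2 * M * ε ^ κ) (𝓝[>] 0) (𝓝 0) := by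
    have h0 : Tendsto (fun ε : ℝ => ε ^ κ) (𝓝[>] 0) (𝓝 0) := by
      have hc : ContinuousAt (fun ε : ℝ => ε ^ κ) 0 :=
        Real.continuousAt_rpow_const 0 κ (Or.inr hκpos.le)
      have h := hc.tendsto
      rw [Real.zero_rpow hκpos.ne'] at h
      exact tendsto_nhdsWithin_of_tendsto_nhds h
    simpa using h0.const_mul (2 * M)
  -- eventually `ε < ε^{1-θ} < ε₁`
  have h1θ : 0 < 1 - θ := by linarith [hθ.2]
  set ε₂ : ℝ := min 1 (ε₁ ^ (1 / (1 - θ))) with hε₂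
  have hε₂pos : 0 < ε₂ := lt_min one_pos (Real.rpow_pos_of_pos hε₁ _)
  have hev : ∀ᶠ ε in 𝓝[>] (0 : ℝ), 0 < ε ∧ ε < ε₂ := by
    filter_upwards [Ioo_mem_nhdsGT hε₂pos] with ε hε using hε
  have hsqueeze : ∀ᶠ ε in 𝓝[>] (0 : ℝ), |D ψ + f ε| ≤ 2 * M * ε ^ κ := by
    filter_upwards [hev] with ε hε
    obtain ⟨hε0, hεlt⟩ := hε
    have hε1 : ε < 1 := hεlt.trans_le (min_le_left _ _)
    have hδ1 : ε < ε ^ (1 - θ) := Real.self_lt_rpow_of_lt_one hε0 hε1 (by linarith [hθ.1])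
    have hδ2 : ε ^ (1 - θ) < ε₁ := by
      have hlt : ε < ε₁ ^ (1 / (1 - θ)) := hεlt.trans_le (min_le_right _ _)
      have h := Real.rpow_lt_rpow hε0.le hlt h1θ
      rwa [← Real.rpow_mul hε₁.le, one_div_mul_cancel h1θ.ne', Real.rpow_one] at h
    have hb := hbound ε (ε ^ (1 - θ)) hε0 hδ1 hδ2
    rw [DeRosaIsett2024_s51_exponent_identity hε0] at hb
    calc |D ψ + f ε| ≤ M * (2 * ε ^ (2 * θ + (1 - θ) * (a - 1))) := hb
      _ = 2 * M * ε ^ κ := by rw [hκ]; ring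
  have hzero : Tendsto (fun ε => D ψ + f ε) (𝓝[>] 0) (𝓝 0) := by
    rw [tendsto_zero_iff_abs_tendsto_zero]
    refine tendsto_of_tendsto_of_tendsto_of_le_of_le' tendsto_const_nhds hpow ?_ hsqueeze
    exact Eventually.of_forall fun ε => abs_nonneg _
  have htwo : Tendsto (fun ε => D ψ + f ε) (𝓝[>] 0) (𝓝 (D ψ + D ψ)) :=
    tendsto_const_nhds.add hlim
  have heq : D ψ + D ψ = 0 := tendsto_nhds_unique htwo hzero
  linarith

end Literature.Barriers.AnomalousDissipation

end
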